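import Literature.NumberTheory.Automorphic.UnitaryGroupPairOrbitalMeasureOfLocal
import Literature.NumberTheory.Automorphic.UnitaryGroupOrbitalMeasureFamilyOfLocal
import HarnessLib

/-!
# The ADELIC-CLASS-indexed orbital measure family of the PRODUCT `H(𝔸) = U(H₂)(𝔸) × U(H₁)(𝔸)` built from local class-indexed families:
# `OrbitalMeasureFamily.ofLocalAdelicPair mH mHi : OrbitalMeasureFamily H(𝔸)` and its exact Euler product
# `Φ([h], f_∞ ⊗ ⊗_v f_v) = Φ_∞([h_∞], f_∞) · ∏_v Φ_v([h_v], f_v)` (Rogawski (1990) §4.3 p. 44, §5.4 (5.4.3) pp. 72–73; Gelbart (1975) (9.13), (10.19))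

Topic `NumberTheory/Automorphic`; namespace `Literature.NumberTheory.Automorphic.UnitaryGroup`.  Definitions (with bodies) and theorems; no
instance, no named fact, no notation, no `sorry`.  The `H`-side twin of ★ C3 `UnitaryGroupOrbitalMeasureFamilyOfLocalAdelic` (one unitary datum):
the endoscopic group of `U(3)` is the PRODUCT `H = U(2) × U(1)` [Rogawski1990, §4.9], whose adelic points in the tree are
`(cmDatum L N₂ H₂).Adelic × (cmDatum L N₁ H₁).Adelic` (★ `pairAdelic`; the ENGINE T1 line's `HAdelic L`, ★ `PureTensor₂`, ★
`adelicStableOrbitalIntegralH (mH : OrbitalMeasureFamily (HAdelic L))`), and whose local orbital measure families `mH v` are CLASS-indexed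
families on the product local groups `U(H₂)(L⁺_v) × U(H₁)(L⁺_v)` (★ `pairLocal`; the carrier of ★ `IsLocalDeltaTransfer`; they need NOT be product
measures).  Everything is GENERIC in `(N₂, H₂, N₁, H₁)`.  Imports ★ `UnitaryGroupPairOrbitalMeasureOfLocal` (`pairAdelicOrbitalMeasureOfLocal`,
`…_spec`, `orbitalIntegral_eval_pairAdelicOrbitalMeasureOfLocal_eq_mul_prod'`) and ★ C2 `UnitaryGroupOrbitalMeasureFamilyOfLocal`
(`OrbitalMeasureFamily.atPoint`, `orbitalIntegral_atPoint`).

* §1 the `out`-choice on the pair: `conjClassesMk_pairToLocal_out_eq`, `conjClassesMk_pairArchPart_out_eq` — the local ∕ archimedean classes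
  read at the chosen representative `out [h]` ARE those of `h` (`pairToLocal v`, `pairArchPart` are homomorphisms).
* §2 **`IsNormalisedOffPair L H₂ H₁ mH h S₀`** — «`(mH v).atPoint h_v (π (U(H₂)(𝒪_v) ×ˢ U(H₁)(𝒪_v))) = 1` for `v ∉ S₀`» (the a.a.-`v`
  normalisation `vol(K_{H,v}) = 1` of [Rogawski1990, §4.3 p. 44] read at `h`; the literal of ★ `UnramifiedOrbitalUnitFactorPair` §§3–4);
  **`OrbitalMeasureFamily.ofLocalAdelicPair L H₂ H₁ mH mHi : OrbitalMeasureFamily (pairAdelic L H₂ H₁)`** — at an adelic class `c` with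
  representative `h = out c`, ★ `pairAdelicOrbitalMeasureOfLocal` at `h` of `mHi.atPoint h_∞` and the `(mH v).atPoint h_v` (any exceptional
  finite set off which the family is normalised at `h`; `0` if there is none — junk); `ofLocalAdelicPair_eq` (it IS that construction for every
  admissible normalising `S₀`), `ofLocalAdelicPair_admissible` (invariant, finite on compacta, `≠ 0`), and the exact Euler product
  **`classOrbitalIntegral_ofLocalAdelicPair_eval_eq_mul_prod`**: for an unramified ★ `PureTensor₂` `T = f_∞ ⊗ ⊗_v f_v` whose orbital integrand at
  `h` is integrable and whose local CLASS orbital integrals are `1` off a finite `S₂`,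
  `classOrbitalIntegral (ofLocalAdelicPair mH mHi) T.eval c = classOrbitalIntegral mHi T.arch [h_∞] · ∏_{v∈S₂} classOrbitalIntegral (mH v) (T.loc v) [h_v]`
  — Rogawski's `Φ(γ, f) = ∏_v Φ(γ_v, f_v)` on `H` with NO constant, every factor the transfer relations' own (★ `IsLocalDeltaTransfer`), in the
  `∃ S₂, (∀ v ∉ S₂, Φ_v = 1) ∧ Φ = Φ_∞ · ∏_{v∈S₂} Φ_v` shape of ★ `MatchingAdeleH.isEulerOnClasses_of_factor_finset` (`[h_v] = ⟦MonoidHom.prodMap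
  (toLocal v) (toLocal v) (out c)⟧` there IS `⟦pairToLocal v (out c)⟧` here, `pairToLocal` being that `MonoidHom.prodMap` by definition).

## References
* J. D. Rogawski, *Automorphic Representations of Unitary Groups in Three Variables* (1990), §4.3 p. 44, §4.9 p. 54, §5.4 (5.4.3) pp. 71–73
  [Rogawski1990].
* S. Gelbart, *Automorphic forms on adele groups*, Ann. of Math. Stud. 83 (1975), (9.13), p. 155 (10.19) [Gelbart1975].
-/

noncomputable section

open MeasureTheory Measure Set Filter Topology NumberField IsDedekindDomain
open Literature.MeasureTheory.Group
open scoped ENNReal NNReal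

namespace Literature.NumberTheory.Automorphic

namespace UnitaryGroup

variable (L : Type) [Field L] [NumberField L] [IsCMField L] {N₂ N₁ : ℕ}
  (H₂ : Matrix (Fin N₂) (Fin N₂) L) (H₁ : Matrix (Fin N₁) (Fin N₁) L)

/-! ## §1 The `out`-choice on the pair: local classes at `out [h]` are those at `h` -/

/-- **The local class at the chosen representative is the local class of `h`**: `[(out [h])_v] = [h_v]` — conjugate pairs of adeles have
conjugate components (`pairToLocal v` is a homomorphism). [cite: Rogawski1990, §5.4 p. 72] -/
theorem conjClassesMk_pairToLocal_out_eq (h : pairAdelic L H₂ H₁) (v : HeightOneSpectrum (𝓞 ↥(maximalRealSubfield L))) :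
    ConjClasses.mk (pairToLocal L H₂ H₁ v (Quotient.out (ConjClasses.mk h) : pairAdelic L H₂ H₁)) =
      ConjClasses.mk (pairToLocal L H₂ H₁ v h) :=
  ConjClasses.mk_eq_mk_iff_isConj.2 (MonoidHom.map_isConj _ (ConjClasses.mk_eq_mk_iff_isConj.1 (Quotient.out_eq (ConjClasses.mk h))))

/-- **The archimedean class at the chosen representative is that of `h`**: `[(out [h])_∞] = [h_∞]` (`pairArchPart` is a homomorphism).
[cite: Rogawski1990, §5.4 p. 72] -/
theorem conjClassesMk_pairArchPart_out_eq (h : pairAdelic L H₂ H₁) :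
    ConjClasses.mk (pairArchPart L H₂ H₁ (Quotient.out (ConjClasses.mk h) : pairAdelic L H₂ H₁)) =
      ConjClasses.mk (pairArchPart L H₂ H₁ h) :=
  ConjClasses.mk_eq_mk_iff_isConj.2 (MonoidHom.map_isConj _ (ConjClasses.mk_eq_mk_iff_isConj.1 (Quotient.out_eq (ConjClasses.mk h))))

/-! ## §2 `OrbitalMeasureFamily.ofLocalAdelicPair` and its exact Euler product -/

variable
  [∀ h : pairAdelic L H₂ H₁, MeasurableSpace (pairAdelic L H₂ H₁ ⧸ Subgroup.centralizer ({h} : Set (pairAdelic L H₂ H₁)))]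
  [∀ a : pairArch L H₂ H₁, MeasurableSpace (pairArch L H₂ H₁ ⧸ Subgroup.centralizer ({a} : Set (pairArch L H₂ H₁)))]
  [∀ (v : HeightOneSpectrum (𝓞 ↥(maximalRealSubfield L))) (x : pairLocal L H₂ H₁ v),
    MeasurableSpace (pairLocal L H₂ H₁ v ⧸ Subgroup.centralizer ({x} : Set (pairLocal L H₂ H₁ v)))]
  (mH : ∀ v : HeightOneSpectrum (𝓞 ↥(maximalRealSubfield L)), OrbitalMeasureFamily (pairLocal L H₂ H₁ v))
  (mHi : OrbitalMeasureFamily (pairArch L H₂ H₁))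

/-- **The local family on the pair is normalised at `h` off `S₀`**: `(mH v).atPoint h_v (π (U(H₂)(𝒪_v) ×ˢ U(H₁)(𝒪_v))) = 1` for `v ∉ S₀`
(`h_v = pairToLocal v h`; the `×ˢ` literal of ★ `UnramifiedOrbitalUnitFactorPair`, which SUPPLIES such `S₀` for canonical families at rational
regular `h`). [cite: Rogawski1990, §4.3 p. 44] -/
def IsNormalisedOffPair (h : pairAdelic L H₂ H₁) (S₀ : Finset (HeightOneSpectrum (𝓞 ↥(maximalRealSubfield L)))) : Prop :=
  ∀ v, v ∉ S₀ → (mH v).atPoint (pairToLocal L H₂ H₁ v h)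
    ((QuotientGroup.mk : pairLocal L H₂ H₁ v → _) ''
      ((cmLocalIntegralLevel L N₂ H₂ v : Set ((cmDatum L N₂ H₂).Local v)) ×ˢ
        (cmLocalIntegralLevel L N₁ H₁ v : Set ((cmDatum L N₁ H₁).Local v)))) = 1

/-- **The ADELIC-CLASS-indexed orbital measure family of `H(𝔸) = U(H₂)(𝔸) × U(H₁)(𝔸) BUILT FROM LOCAL CLASS-INDEXED FAMILIES** (the parameter
`mH : OrbitalMeasureFamily (HAdelic L)` of the `H`-side stable sums): at an adelic conjugacy class `c` with representative `h = out c`, the measure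
★ `pairAdelicOrbitalMeasureOfLocal L H₂ H₁ h (mHi.atPoint h_∞) (v ↦ (mH v).atPoint h_v) S₀` for a (chosen) exceptional finite set `S₀` off which the
family is normalised at `h` — independent of that choice (`ofLocalAdelicPair_eq`) — and `0` if there is none (junk); the finite-adelic orbit space
carries its Borel σ-algebra. [cite: Rogawski1990, §5.4 (5.4.3) pp. 72–73] -/
def OrbitalMeasureFamily.ofLocalAdelicPair : OrbitalMeasureFamily (pairAdelic L H₂ H₁) := fun c =>
  letI : MeasurableSpace (pairFinAdelic L H₂ H₁ ⧸
      Subgroup.centralizer ({pairFinPart L H₂ H₁ (Quotient.out c : pairAdelic L H₂ H₁)} : Set (pairFinAdelic L H₂ H₁))) := borel _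
  @dite _ (∃ S₀, IsNormalisedOffPair L H₂ H₁ mH (Quotient.out c : pairAdelic L H₂ H₁) S₀) (Classical.dec _)
    (fun hS => pairAdelicOrbitalMeasureOfLocal L H₂ H₁ (Quotient.out c : pairAdelic L H₂ H₁) (mHi.atPoint (pairArchPart L H₂ H₁ (Quotient.out c : pairAdelic L H₂ H₁)))
      (fun v => (mH v).atPoint (pairToLocal L H₂ H₁ v (Quotient.out c : pairAdelic L H₂ H₁))) hS.choose)
    (fun _ => 0)

variable [∀ (v : HeightOneSpectrum (𝓞 ↥(maximalRealSubfield L))) (x : pairLocal L H₂ H₁ v),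
    BorelSpace (pairLocal L H₂ H₁ v ⧸ Subgroup.centralizer ({x} : Set (pairLocal L H₂ H₁ v)))]
  (c : ConjClasses (pairAdelic L H₂ H₁))

/-- **`ofLocalAdelicPair` IS the construction for EVERY admissible normalising exceptional set**: if the local family is admissible at the classes
`[h_v]` (`h = out c`) and normalised at `h` off `S₀`, then `ofLocalAdelicPair mH mHi c = pairAdelicOrbitalMeasureOfLocal h (mHi.atPoint h_∞)
(v ↦ (mH v).atPoint h_v) S₀` (★ independence of the exceptional set). [cite: Rogawski1990, §5.4 p. 72] -/
theorem OrbitalMeasureFamily.ofLocalAdelicPair_eq {S₀ : Finset (HeightOneSpectrum (𝓞 ↥(maximalRealSubfield L)))}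
    (hS₀ : IsNormalisedOffPair L H₂ H₁ mH (Quotient.out c : pairAdelic L H₂ H₁) S₀)
    (hadm : ∀ v, mH v (ConjClasses.mk (pairToLocal L H₂ H₁ v (Quotient.out c : pairAdelic L H₂ H₁))) ≠ 0 ∧
      SMulInvariantMeasure (pairLocal L H₂ H₁ v) _ (mH v (ConjClasses.mk (pairToLocal L H₂ H₁ v (Quotient.out c : pairAdelic L H₂ H₁)))) ∧
      IsFiniteMeasureOnCompacts (mH v (ConjClasses.mk (pairToLocal L H₂ H₁ v (Quotient.out c : pairAdelic L H₂ H₁))))) :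
    OrbitalMeasureFamily.ofLocalAdelicPair L H₂ H₁ mH mHi c =
      (letI : MeasurableSpace (pairFinAdelic L H₂ H₁ ⧸
      Subgroup.centralizer ({pairFinPart L H₂ H₁ (Quotient.out c : pairAdelic L H₂ H₁)} : Set (pairFinAdelic L H₂ H₁))) := borel _;
        pairAdelicOrbitalMeasureOfLocal L H₂ H₁ (Quotient.out c : pairAdelic L H₂ H₁) (mHi.atPoint (pairArchPart L H₂ H₁ (Quotient.out c : pairAdelic L H₂ H₁)))
          (fun v => (mH v).atPoint (pairToLocal L H₂ H₁ v (Quotient.out c : pairAdelic L H₂ H₁))) S₀) := by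
  classical
  letI : MeasurableSpace (pairFinAdelic L H₂ H₁ ⧸
      Subgroup.centralizer ({pairFinPart L H₂ H₁ (Quotient.out c : pairAdelic L H₂ H₁)} : Set (pairFinAdelic L H₂ H₁))) := borel _
  haveI : BorelSpace (pairFinAdelic L H₂ H₁ ⧸
      Subgroup.centralizer ({pairFinPart L H₂ H₁ (Quotient.out c : pairAdelic L H₂ H₁)} : Set (pairFinAdelic L H₂ H₁))) := ⟨rfl⟩
  haveI : ∀ v, SMulInvariantMeasure (pairLocal L H₂ H₁ v) _ (mH v (ConjClasses.mk (pairToLocal L H₂ H₁ v (Quotient.out c : pairAdelic L H₂ H₁)))) := fun v => (hadm v).2.1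
  haveI : ∀ v, IsFiniteMeasureOnCompacts (mH v (ConjClasses.mk (pairToLocal L H₂ H₁ v (Quotient.out c : pairAdelic L H₂ H₁)))) := fun v => (hadm v).2.2
  haveI : ∀ v, SMulInvariantMeasure (pairLocal L H₂ H₁ v) _ ((mH v).atPoint (pairToLocal L H₂ H₁ v (Quotient.out c : pairAdelic L H₂ H₁))) :=
    fun v => (mH v).smulInvariantMeasure_atPoint _
  haveI : ∀ v, IsFiniteMeasureOnCompacts ((mH v).atPoint (pairToLocal L H₂ H₁ v (Quotient.out c : pairAdelic L H₂ H₁))) :=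
    fun v => (mH v).isFiniteMeasureOnCompacts_atPoint _
  have hne : ∀ v, (mH v).atPoint (pairToLocal L H₂ H₁ v (Quotient.out c : pairAdelic L H₂ H₁)) ≠ 0 := fun v => (mH v).atPoint_ne_zero _ (hadm v).1
  have hex : ∃ S₀, IsNormalisedOffPair L H₂ H₁ mH (Quotient.out c : pairAdelic L H₂ H₁) S₀ := ⟨S₀, hS₀⟩
  have hdef : OrbitalMeasureFamily.ofLocalAdelicPair L H₂ H₁ mH mHi c =
      pairAdelicOrbitalMeasureOfLocal L H₂ H₁ (Quotient.out c : pairAdelic L H₂ H₁) (mHi.atPoint (pairArchPart L H₂ H₁ (Quotient.out c : pairAdelic L H₂ H₁)))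
        (fun v => (mH v).atPoint (pairToLocal L H₂ H₁ v (Quotient.out c : pairAdelic L H₂ H₁))) hex.choose := by
    show @dite _ (∃ S₀, IsNormalisedOffPair L H₂ H₁ mH (Quotient.out c : pairAdelic L H₂ H₁) S₀) (Classical.dec _) _ _ = _
    rw [dif_pos hex]
  rw [hdef]
  -- both exceptional sets give the finite-adelic measure at `S₀ ∪ hex.choose`
  have h1 := (pairFinAdelicOrbitalMeasureOfLocal_spec L H₂ H₁ (Quotient.out c : pairAdelic L H₂ H₁) (fun v => (mH v).atPoint (pairToLocal L H₂ H₁ v (Quotient.out c : pairAdelic L H₂ H₁))) hS₀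
    (fun v _ => hne v)).2.2.2.1 (S₀ ∪ hex.choose) Finset.subset_union_left
  have h2 := (pairFinAdelicOrbitalMeasureOfLocal_spec L H₂ H₁ (Quotient.out c : pairAdelic L H₂ H₁) (fun v => (mH v).atPoint (pairToLocal L H₂ H₁ v (Quotient.out c : pairAdelic L H₂ H₁))) hex.choose_spec
    (fun v _ => hne v)).2.2.2.1 (S₀ ∪ hex.choose) Finset.subset_union_right
  unfold pairAdelicOrbitalMeasureOfLocal
  rw [← h2, h1]

variable [∀ h : pairAdelic L H₂ H₁, BorelSpace (pairAdelic L H₂ H₁ ⧸ Subgroup.centralizer ({h} : Set (pairAdelic L H₂ H₁)))]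
  [∀ a : pairArch L H₂ H₁, BorelSpace (pairArch L H₂ H₁ ⧸ Subgroup.centralizer ({a} : Set (pairArch L H₂ H₁)))]

/-- **`ofLocalAdelicPair` is ADMISSIBLE at every class where the local data are admissible and normalised**: invariant, finite on compacta, non-zero.
[cite: Rogawski1990, §5.4 p. 72] -/
theorem OrbitalMeasureFamily.ofLocalAdelicPair_admissible {S₀ : Finset (HeightOneSpectrum (𝓞 ↥(maximalRealSubfield L)))}
    (hS₀ : IsNormalisedOffPair L H₂ H₁ mH (Quotient.out c : pairAdelic L H₂ H₁) S₀)
    (hadm : ∀ v, mH v (ConjClasses.mk (pairToLocal L H₂ H₁ v (Quotient.out c : pairAdelic L H₂ H₁))) ≠ 0 ∧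
      SMulInvariantMeasure (pairLocal L H₂ H₁ v) _ (mH v (ConjClasses.mk (pairToLocal L H₂ H₁ v (Quotient.out c : pairAdelic L H₂ H₁)))) ∧
      IsFiniteMeasureOnCompacts (mH v (ConjClasses.mk (pairToLocal L H₂ H₁ v (Quotient.out c : pairAdelic L H₂ H₁)))))
    (hadmA : mHi (ConjClasses.mk (pairArchPart L H₂ H₁ (Quotient.out c : pairAdelic L H₂ H₁))) ≠ 0 ∧
      SMulInvariantMeasure (pairArch L H₂ H₁) _ (mHi (ConjClasses.mk (pairArchPart L H₂ H₁ (Quotient.out c : pairAdelic L H₂ H₁)))) ∧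
      IsFiniteMeasureOnCompacts (mHi (ConjClasses.mk (pairArchPart L H₂ H₁ (Quotient.out c : pairAdelic L H₂ H₁))))) :
    SMulInvariantMeasure (pairAdelic L H₂ H₁) _ (OrbitalMeasureFamily.ofLocalAdelicPair L H₂ H₁ mH mHi c) ∧
      IsFiniteMeasureOnCompacts (OrbitalMeasureFamily.ofLocalAdelicPair L H₂ H₁ mH mHi c) ∧
      OrbitalMeasureFamily.ofLocalAdelicPair L H₂ H₁ mH mHi c ≠ 0 := by
  letI : MeasurableSpace (pairFinAdelic L H₂ H₁ ⧸
      Subgroup.centralizer ({pairFinPart L H₂ H₁ (Quotient.out c : pairAdelic L H₂ H₁)} : Set (pairFinAdelic L H₂ H₁))) := borel _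
  haveI : BorelSpace (pairFinAdelic L H₂ H₁ ⧸
      Subgroup.centralizer ({pairFinPart L H₂ H₁ (Quotient.out c : pairAdelic L H₂ H₁)} : Set (pairFinAdelic L H₂ H₁))) := ⟨rfl⟩
  haveI : ∀ v, SMulInvariantMeasure (pairLocal L H₂ H₁ v) _ (mH v (ConjClasses.mk (pairToLocal L H₂ H₁ v (Quotient.out c : pairAdelic L H₂ H₁)))) := fun v => (hadm v).2.1
  haveI : ∀ v, IsFiniteMeasureOnCompacts (mH v (ConjClasses.mk (pairToLocal L H₂ H₁ v (Quotient.out c : pairAdelic L H₂ H₁)))) := fun v => (hadm v).2.2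
  haveI : ∀ v, SMulInvariantMeasure (pairLocal L H₂ H₁ v) _ ((mH v).atPoint (pairToLocal L H₂ H₁ v (Quotient.out c : pairAdelic L H₂ H₁))) :=
    fun v => (mH v).smulInvariantMeasure_atPoint _
  haveI : ∀ v, IsFiniteMeasureOnCompacts ((mH v).atPoint (pairToLocal L H₂ H₁ v (Quotient.out c : pairAdelic L H₂ H₁))) :=
    fun v => (mH v).isFiniteMeasureOnCompacts_atPoint _
  haveI := hadmA.2.1
  haveI := hadmA.2.2
  haveI : SMulInvariantMeasure (pairArch L H₂ H₁) _ (mHi.atPoint (pairArchPart L H₂ H₁ (Quotient.out c : pairAdelic L H₂ H₁))) := mHi.smulInvariantMeasure_atPoint _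
  haveI : IsFiniteMeasureOnCompacts (mHi.atPoint (pairArchPart L H₂ H₁ (Quotient.out c : pairAdelic L H₂ H₁))) := mHi.isFiniteMeasureOnCompacts_atPoint _
  haveI : SFinite (mHi.atPoint (pairArchPart L H₂ H₁ (Quotient.out c : pairAdelic L H₂ H₁))) := by
    haveI : IsLocallyFiniteMeasure (mHi.atPoint (pairArchPart L H₂ H₁ (Quotient.out c : pairAdelic L H₂ H₁))) := isLocallyFiniteMeasure_of_isFiniteMeasureOnCompacts
    haveI : SigmaFinite (mHi.atPoint (pairArchPart L H₂ H₁ (Quotient.out c : pairAdelic L H₂ H₁))) := sigmaFinite_of_locallyFinite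
    infer_instance
  have h := pairAdelicOrbitalMeasureOfLocal_spec L H₂ H₁ (Quotient.out c : pairAdelic L H₂ H₁) (mHi.atPoint (pairArchPart L H₂ H₁ (Quotient.out c : pairAdelic L H₂ H₁)))
    (fun v => (mH v).atPoint (pairToLocal L H₂ H₁ v (Quotient.out c : pairAdelic L H₂ H₁))) (mHi.atPoint_ne_zero _ hadmA.1) hS₀
    (fun v _ => (mH v).atPoint_ne_zero _ (hadm v).1)
  rw [OrbitalMeasureFamily.ofLocalAdelicPair_eq L H₂ H₁ mH mHi c hS₀ hadm]
  exact ⟨h.1, h.2.1, h.2.2.1⟩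

/-- **THE EXACT EULER PRODUCT FOR `ofLocalAdelicPair` IN CLASS CURRENCY.**  At an adelic class `c` of `H(𝔸)` (`h = out c`, `h_v = pairToLocal v h`,
`h_∞ = pairArchPart h`) where the local families are admissible and normalised off `S₀`: for every UNRAMIFIED pure tensor `T = f_∞ ⊗ ⊗_v f_v` on the
pair (★ `PureTensor₂.IsUnramified₂`) whose orbital integrand at `h` is integrable for `ofLocalAdelicPair mH mHi c` and whose local CLASS orbital
integrals are `1` off a finite `S₂`,
`classOrbitalIntegral (ofLocalAdelicPair mH mHi) T.eval c = classOrbitalIntegral mHi T.arch [h_∞] · ∏_{v∈S₂} classOrbitalIntegral (mH v) (T.loc v) [h_v]`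
— `Φ(γ, f) = ∏_v Φ(γ_v, f_v)` on `H` [Rogawski1990, §5.4 p. 72] with NO constant, every factor the transfer relations' own. [cite: Rogawski1990, §5.4 p. 72]
[cite: Gelbart1975, p. 155 (10.19)] -/
theorem classOrbitalIntegral_ofLocalAdelicPair_eval_eq_mul_prod {S₀ : Finset (HeightOneSpectrum (𝓞 ↥(maximalRealSubfield L)))}
    (hS₀ : IsNormalisedOffPair L H₂ H₁ mH (Quotient.out c : pairAdelic L H₂ H₁) S₀)
    (hadm : ∀ v, mH v (ConjClasses.mk (pairToLocal L H₂ H₁ v (Quotient.out c : pairAdelic L H₂ H₁))) ≠ 0 ∧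
      SMulInvariantMeasure (pairLocal L H₂ H₁ v) _ (mH v (ConjClasses.mk (pairToLocal L H₂ H₁ v (Quotient.out c : pairAdelic L H₂ H₁)))) ∧
      IsFiniteMeasureOnCompacts (mH v (ConjClasses.mk (pairToLocal L H₂ H₁ v (Quotient.out c : pairAdelic L H₂ H₁)))))
    (hadmA : mHi (ConjClasses.mk (pairArchPart L H₂ H₁ (Quotient.out c : pairAdelic L H₂ H₁))) ≠ 0 ∧
      SMulInvariantMeasure (pairArch L H₂ H₁) _ (mHi (ConjClasses.mk (pairArchPart L H₂ H₁ (Quotient.out c : pairAdelic L H₂ H₁)))) ∧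
      IsFiniteMeasureOnCompacts (mHi (ConjClasses.mk (pairArchPart L H₂ H₁ (Quotient.out c : pairAdelic L H₂ H₁)))))
    (T : PureTensor₂ L H₂ H₁) (S₂ : Finset (HeightOneSpectrum (𝓞 ↥(maximalRealSubfield L)))) (hT : T.IsUnramified₂)
    (hFi : Integrable (descConj (Quotient.out c : pairAdelic L H₂ H₁)
      (Subgroup.centralizer ({(Quotient.out c : pairAdelic L H₂ H₁)} : Set (pairAdelic L H₂ H₁))) (centralizer_comm _) T.eval)
      (OrbitalMeasureFamily.ofLocalAdelicPair L H₂ H₁ mH mHi c))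
    (hf1 : ∀ v, v ∉ S₂ → classOrbitalIntegral (mH v) (T.loc v) (ConjClasses.mk (pairToLocal L H₂ H₁ v (Quotient.out c : pairAdelic L H₂ H₁))) = 1) :
    classOrbitalIntegral (OrbitalMeasureFamily.ofLocalAdelicPair L H₂ H₁ mH mHi) T.eval c =
      classOrbitalIntegral mHi T.arch (ConjClasses.mk (pairArchPart L H₂ H₁ (Quotient.out c : pairAdelic L H₂ H₁))) *
        ∏ v ∈ S₂, classOrbitalIntegral (mH v) (T.loc v) (ConjClasses.mk (pairToLocal L H₂ H₁ v (Quotient.out c : pairAdelic L H₂ H₁))) := by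
  letI : MeasurableSpace (pairFinAdelic L H₂ H₁ ⧸
      Subgroup.centralizer ({pairFinPart L H₂ H₁ (Quotient.out c : pairAdelic L H₂ H₁)} : Set (pairFinAdelic L H₂ H₁))) := borel _
  haveI : BorelSpace (pairFinAdelic L H₂ H₁ ⧸
      Subgroup.centralizer ({pairFinPart L H₂ H₁ (Quotient.out c : pairAdelic L H₂ H₁)} : Set (pairFinAdelic L H₂ H₁))) := ⟨rfl⟩
  haveI : ∀ v, SMulInvariantMeasure (pairLocal L H₂ H₁ v) _ (mH v (ConjClasses.mk (pairToLocal L H₂ H₁ v (Quotient.out c : pairAdelic L H₂ H₁)))) := fun v => (hadm v).2.1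
  haveI : ∀ v, IsFiniteMeasureOnCompacts (mH v (ConjClasses.mk (pairToLocal L H₂ H₁ v (Quotient.out c : pairAdelic L H₂ H₁)))) := fun v => (hadm v).2.2
  haveI : ∀ v, SMulInvariantMeasure (pairLocal L H₂ H₁ v) _ ((mH v).atPoint (pairToLocal L H₂ H₁ v (Quotient.out c : pairAdelic L H₂ H₁))) :=
    fun v => (mH v).smulInvariantMeasure_atPoint _
  haveI : ∀ v, IsFiniteMeasureOnCompacts ((mH v).atPoint (pairToLocal L H₂ H₁ v (Quotient.out c : pairAdelic L H₂ H₁))) :=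
    fun v => (mH v).isFiniteMeasureOnCompacts_atPoint _
  haveI := hadmA.2.1
  haveI := hadmA.2.2
  haveI : SMulInvariantMeasure (pairArch L H₂ H₁) _ (mHi.atPoint (pairArchPart L H₂ H₁ (Quotient.out c : pairAdelic L H₂ H₁))) := mHi.smulInvariantMeasure_atPoint _
  haveI : IsFiniteMeasureOnCompacts (mHi.atPoint (pairArchPart L H₂ H₁ (Quotient.out c : pairAdelic L H₂ H₁))) := mHi.isFiniteMeasureOnCompacts_atPoint _
  haveI : SFinite (mHi.atPoint (pairArchPart L H₂ H₁ (Quotient.out c : pairAdelic L H₂ H₁))) := by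
    haveI : IsLocallyFiniteMeasure (mHi.atPoint (pairArchPart L H₂ H₁ (Quotient.out c : pairAdelic L H₂ H₁))) := isLocallyFiniteMeasure_of_isFiniteMeasureOnCompacts
    haveI : SigmaFinite (mHi.atPoint (pairArchPart L H₂ H₁ (Quotient.out c : pairAdelic L H₂ H₁))) := sigmaFinite_of_locallyFinite
    infer_instance
  have heq := OrbitalMeasureFamily.ofLocalAdelicPair_eq L H₂ H₁ mH mHi c hS₀ hadm
  rw [heq] at hFi
  change orbitalIntegral (Quotient.out c : pairAdelic L H₂ H₁) T.eval (OrbitalMeasureFamily.ofLocalAdelicPair L H₂ H₁ mH mHi c) = _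
  rw [heq,
    orbitalIntegral_eval_pairAdelicOrbitalMeasureOfLocal_eq_mul_prod' L H₂ H₁ (Quotient.out c : pairAdelic L H₂ H₁) (mHi.atPoint (pairArchPart L H₂ H₁ (Quotient.out c : pairAdelic L H₂ H₁)))
      (fun v => (mH v).atPoint (pairToLocal L H₂ H₁ v (Quotient.out c : pairAdelic L H₂ H₁))) (mHi.atPoint_ne_zero _ hadmA.1) hS₀
      (fun v _ => (mH v).atPoint_ne_zero _ (hadm v).1) T S₂ hT hFi
      (fun v hv => by rw [(mH v).orbitalIntegral_atPoint]; exact hf1 v hv),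
    mHi.orbitalIntegral_atPoint]
  exact congrArg _ (Finset.prod_congr rfl fun v _ => (mH v).orbitalIntegral_atPoint _ _)

/-- **The headline in the `∃ S₂` shape of ★ `MatchingAdeleH.isEulerOnClasses_of_factor_finset` (its hypothesis `hfac`, one class at a time)**:
under the same admissibility ∕ normalisation ∕ integrability hypotheses, if the local class orbital integrals of `T` at `[h_v]` are `1` off SOME
finite set, then `∃ S₂, (∀ v ∉ S₂, Φ_v([h_v], f_v) = 1) ∧ Φ(c, T.eval) = Φ_∞([h_∞], f_∞) · ∏_{v∈S₂} Φ_v([h_v], f_v)`.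
[cite: Rogawski1990, §5.4 (5.4.3) pp. 72–73] -/
theorem exists_finset_classOrbitalIntegral_ofLocalAdelicPair_eval_eq_mul_prod
    {S₀ : Finset (HeightOneSpectrum (𝓞 ↥(maximalRealSubfield L)))}
    (hS₀ : IsNormalisedOffPair L H₂ H₁ mH (Quotient.out c : pairAdelic L H₂ H₁) S₀)
    (hadm : ∀ v, mH v (ConjClasses.mk (pairToLocal L H₂ H₁ v (Quotient.out c : pairAdelic L H₂ H₁))) ≠ 0 ∧
      SMulInvariantMeasure (pairLocal L H₂ H₁ v) _ (mH v (ConjClasses.mk (pairToLocal L H₂ H₁ v (Quotient.out c : pairAdelic L H₂ H₁)))) ∧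
      IsFiniteMeasureOnCompacts (mH v (ConjClasses.mk (pairToLocal L H₂ H₁ v (Quotient.out c : pairAdelic L H₂ H₁)))))
    (hadmA : mHi (ConjClasses.mk (pairArchPart L H₂ H₁ (Quotient.out c : pairAdelic L H₂ H₁))) ≠ 0 ∧
      SMulInvariantMeasure (pairArch L H₂ H₁) _ (mHi (ConjClasses.mk (pairArchPart L H₂ H₁ (Quotient.out c : pairAdelic L H₂ H₁)))) ∧
      IsFiniteMeasureOnCompacts (mHi (ConjClasses.mk (pairArchPart L H₂ H₁ (Quotient.out c : pairAdelic L H₂ H₁)))))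
    (T : PureTensor₂ L H₂ H₁) (hT : T.IsUnramified₂)
    (hFi : Integrable (descConj (Quotient.out c : pairAdelic L H₂ H₁)
      (Subgroup.centralizer ({(Quotient.out c : pairAdelic L H₂ H₁)} : Set (pairAdelic L H₂ H₁))) (centralizer_comm _) T.eval)
      (OrbitalMeasureFamily.ofLocalAdelicPair L H₂ H₁ mH mHi c))
    (hf1 : ∃ S₂ : Finset (HeightOneSpectrum (𝓞 ↥(maximalRealSubfield L))),
      ∀ v, v ∉ S₂ → classOrbitalIntegral (mH v) (T.loc v) (ConjClasses.mk (pairToLocal L H₂ H₁ v (Quotient.out c : pairAdelic L H₂ H₁))) = 1) :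
    ∃ S₂ : Finset (HeightOneSpectrum (𝓞 ↥(maximalRealSubfield L))),
      (∀ v, v ∉ S₂ → classOrbitalIntegral (mH v) (T.loc v) (ConjClasses.mk (pairToLocal L H₂ H₁ v (Quotient.out c : pairAdelic L H₂ H₁))) = 1) ∧
      classOrbitalIntegral (OrbitalMeasureFamily.ofLocalAdelicPair L H₂ H₁ mH mHi) T.eval c =
        classOrbitalIntegral mHi T.arch (ConjClasses.mk (pairArchPart L H₂ H₁ (Quotient.out c : pairAdelic L H₂ H₁))) *
          ∏ v ∈ S₂, classOrbitalIntegral (mH v) (T.loc v) (ConjClasses.mk (pairToLocal L H₂ H₁ v (Quotient.out c : pairAdelic L H₂ H₁))) := by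
  obtain ⟨S₂, hS₂⟩ := hf1
  exact ⟨S₂, hS₂, classOrbitalIntegral_ofLocalAdelicPair_eval_eq_mul_prod L H₂ H₁ mH mHi c hS₀ hadm hadmA T S₂ hT hFi hS₂⟩

end UnitaryGroup

end Literature.NumberTheory.Automorphic

end
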